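import Summits.BirchSwinnertonDyer.Rank1Residual.X5.SelmerSolitaireQuadraticOnePrime
import Summits.BirchSwinnertonDyer.Rank1Residual.X5.SelmerSolitaireQuadraticRebase
import HarnessLib

/-!
# Selmer solitaire, QUADRATIC-SPACE LAYER (ii‴) — the ANY-CORE corollary: model T4 between any two core vertices

Cell `b2b-bsdres`, O1 programme (p = 2), ORDER v2.9 pool slot (ii‴) (o1 lead GEN 23, l.5587: "the
any-core corollary (cores `A`, `B` of any TS Lagrangian) is a ≤ 10-line consequence of
`exists_move_core_chain` + p3's `exists_rebase_coreQ_empty` BY NAME"; home = p4 as the 1-theorem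
follow-up `…QuadraticOnePrimeRebase.lean`, x11b3-p3 GEN 8 l.5633); pool hand x11b3-p4 GEN 5. Imports
Q8 (`X5.SelmerSolitaireQuadraticOnePrime`, p288535: `exists_move_core_chain`) and p3's QS-REBASE
(`X5.SelmerSolitaireQuadraticRebase`, p288920: `exists_rebase_coreQ_empty`). THEOREMS ONLY (no
definition, no named fact, no `sorry`).

HONEST FRAMING (cell, verbatim): research route; pure `𝔽₂` linear algebra — no curve, no Galois group,
no prime; the arithmetic reading (2G10.1: re-basing at a core vertex `A` = passing to the twist
`E^{χ_A}` (M4); one Kolyvagin prime then connects `A` to `B`) is NOT asserted here; reach-neutral (R1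
closes no class); nothing booked; no mark / label / count moved; O1 OPEN.

## What is proved
**`exists_move_core_chain_of_coreQ`** — for a totally singular Lagrangian `U` of `Q_D` and ANY two core
vertices `A`, `B`: after re-basing at `A` (a totally singular Lagrangian `U′` whose cores are the
translates, `CoreQ U′ n ↔ CoreQ U (n ∆ A)`, p3's `exists_rebase_coreQ_empty`) there is ONE move (a
functional `ψ` and THE forced Lagrangian `L` over `K′_ψ(U′)` avoiding `u_q`) and an ordering
`c₁, …, c_d` of `B ∆ A` with `{q}, {c₁, q}, …, (B ∆ A) ∪ {q}` all core for `L` (Q8's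
`exists_move_core_chain` applied to `U′`, whose `∅` is core and for which `B ∆ A` is core since
`(B ∆ A) ∆ A = B`). This is 2G10.1's "[QS1/QS1c] after re-basing at any core vertex `A` … [(ii′)]
`onePrimeConnection_holds`" composed in the model, AR-free.

## References
* lens-2 GEN 10 2G10.1 / 2G10.5 (`cells/o1/ROUTES-O1.md` l.1966–1988); B. Mazur, K. Rubin,
  Contemp. Math. 358 (2004), §5 (the graph `𝒳⁰`) [MazurRubin2004Intro].
* Tree: `exists_move_core_chain` (p4, Q8), `exists_rebase_coreQ_empty` (p3, QS-REBASE); Mathlib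
  `symmDiff_symmDiff_cancel_right`. Dedup: `lean search 'exists_move_core_chain_of_coreQ'` → none.
-/

namespace Summit.BirchSwinnertonDyer.Rank1Residual.X5.SelmerSolitaire.Quadratic

open Finset SelmerSolitaire

variable {s : ℕ}

/-- **Model T4 between ANY two core vertices**: for a totally singular Lagrangian `U` of `Q_D` with
core vertices `A` and `B`, the re-based Lagrangian `U′` at `A` (cores = translates by `A`) admits one
move `(ψ, L)` and an ordering `c₁ … c_d` of `B ∆ A` with `{q}, {c₁, q}, …, (B ∆ A) ∪ {q}` all core for
the forced Lagrangian `L`. [cite: MazurRubin2004Intro, §5 (𝒳⁰)] -/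
theorem exists_move_core_chain_of_coreQ {U : Submodule (ZMod 2) (QVec s)} (hU : IsTSLagrangian U)
    {A B : Finset (Fin s)} (hA : CoreQ U A) (hB : CoreQ U B) :
    ∃ U' : Submodule (ZMod 2) (QVec s), IsTSLagrangian U' ∧
      (∀ n, CoreQ U' n ↔ CoreQ U (symmDiff n A)) ∧
      ∃ (ψ : QVec s →ₗ[ZMod 2] ZMod 2) (L : Submodule (ZMod 2) (QVec (s + 1))) (l : List (Fin s)),
        (IsTSLagrangian L ∧ kPrime U' ψ ⊆ (L : Set (QVec (s + 1))) ∧ uNew s ∉ L) ∧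
          l.Nodup ∧ l.toFinset = symmDiff B A ∧
            ∀ i ≤ l.length, CoreQ L (withNew (l.take i).toFinset) := by
  obtain ⟨U', hU', h0, hcore⟩ := exists_rebase_coreQ_empty U hU hA
  have hBA : CoreQ U' (symmDiff B A) := (hcore _).mpr (by rwa [symmDiff_symmDiff_cancel_right])
  exact ⟨U', hU', hcore, exists_move_core_chain hU' h0 hBA⟩

end Summit.BirchSwinnertonDyer.Rank1Residual.X5.SelmerSolitaire.Quadratic
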